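import Literature.Topology.FourManifolds.SimplifiedBrokenLefschetzRoundSlices
import Literature.Topology.FourManifolds.SimplifiedBrokenLefschetzSidesGenus
import Literature.Topology.FourManifolds.SimplifiedBrokenLefschetzHeight
import Literature.Topology.FourManifolds.SlabMorseCount
import Literature.Topology.FourManifolds.MorseTurnAbout
import Literature.AlgebraicTopology.SingularHomology.MayerVietorisEuler
import HarnessLib

/-!
# Round slices of a simplified broken Lefschetz fibration, II: the transverse slice through a
# round point is an index-`1` cobordism from the lower side to the higher side

Topic `Literature/Topology/FourManifolds`; a brick for the named fact
`Literature.Topology.FourManifolds.nonempty_diffeomorph_sphere_four_of_sblf_genus_one_noLefschetz`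
(Baykur–Kamada 2015, Lemma 11) of `SimplifiedBrokenLefschetzFibration.lean`, completing
`SimplifiedBrokenLefschetzRoundSlices.lean`.  Everything here is **proved**; there are no
definitions and no named facts.

Baykur 2012, proof of Lemma 7: *"a round cobordism … is composed of `S¹` times a `3`-dimensional
`1`-handle cobordism"*; Baykur–Kamada 2015, §2: crossing the round image from the lower side
(genus `g - 1`) to the higher side (genus `g`) is a fibrewise `1`-handle attachment.  For an SBLF
`f : X⁴ → S²` without Lefschetz points on a closed `X`, with equatorial round image
`E = {y₂ = 0}` and higher pole `v = (0, 0, σ)` (`σ = ±1`; the hemisphere of `v` carries the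
genus-`(h+1)` fibres, `IsSimplifiedBrokenLefschetzFibration.exists_pole_lower_higher_sides`),
the companion file proved that on the meridian slice `P = f⁻¹{y₁ = 0}` the slice function
`⟪a, f⟫`, `a = (a₀, 0, a₂)`, has at the two round points `q±` of `P` (over `(±1, 0, 0)`)
nondegenerate critical points of index `1` or `2` according to the sign of `a₂ ∂ₛΓ₂`.  Here the
sign is determined: **`σ ∂ₛΓ₂ > 0` in every centred fold chart at `q±`, i.e. the `s > 0` side
of the fold normal form `(t, s) = (t, x₁² + x₂² - x₃²)` is the higher-genus hemisphere**
(`IsSimplifiedBrokenLefschetzFibration.mul_fderiv_symm_pos_of_fold_chart`), so that **the slice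
function increasing towards the higher pole has index exactly `1` at the round points**
(`morseIndex_height_comp_incl_eq_one_of_round`, `morseIndex_height_comp_incl_eq_of_round`): the `3`-dimensional slice is an elementary
cobordism of index `1` from a lower-side fibre to a higher-side fibre.

The proof is the Euler-characteristic count of the slab `W = {-1 ≤ ⟪a, f⟫ ≤ 1} ∩ P` for the
slice height `a = (3/4, 0, σ)` (`‖a‖ = 5/4`): its critical points are exactly `q₊`, `q₋`
(values `±3/4`; the other critical points of `⟪a, f⟫|_P` have `⟪a, f⟫ = ±5/4`,
`sq_height_eq_of_isMCriticalPt_comp_incl`), its bottom `{⟪a, f⟫ = -1} ∩ P` is the union of the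
two fibres over `(0, 0, -σ)` and `(-24/25, 0, -7σ/25)` (lower side, `χ = 2 - 2h` each) and its top
the union of the fibres over `(0, 0, σ)`, `(24/25, 0, 7σ/25)` (higher side, `χ = -2h` each).  By
the Morse count on a regular slab (`finRelHomology_and_relEuler_slab_of_nondegenerate`, Milnor
1965, §3 / Thm. 7.4) for `⟪a, f⟫|_P` and for `-⟪a, f⟫|_P` (turning the triad about flips the
index `i ↦ 3 - i`, `morseIndex_const_sub_add`),
`χ(W, bottom) = (-1)^{i₊} + (-1)^{i₋}` and `χ(W, top) = -((-1)^{i₊} + (-1)^{i₋})`, while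
`χ(W, bottom) - χ(W, top) = χ(top) - χ(bottom) = -4` (long exact sequences of the pairs); hence
`(-1)^{i₊} + (-1)^{i₋} = -2` and `i₊ = i₋ = 1`.

* `morseCount_Ioo_eq_of_pair` — bookkeeping: the signed Morse count over an open slab whose
  critical points are two given points.
* `finRelHomology_and_relEuler_of_isClosed_union` — `χ` is additive on a disjoint union of two
  closed subspaces.
* `IsSimplifiedBrokenLefschetzFibration.finRelHomology_and_relEuler_preimage_of_genus` — a regular
  fibre of genus `g` has `χ(f⁻¹(y)) = 2 - 2g`.
* `IsSimplifiedBrokenLefschetzFibration.finRelHomology_and_relEuler_sliceLevel` — the levels `±1`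
  of the slice height `a = (3/4, 0, σ)` on the meridian slice are pairs of fibres on one side,
  `χ = 2 (2 - 2g)`.
* `IsSimplifiedBrokenLefschetzFibration.morseIndex_height_comp_incl_eq_one_of_round` — for
  `a = (3/4, 0, σ)` the round points of `P` have index `1` for `⟪a, f⟫|_P`.
* `IsSimplifiedBrokenLefschetzFibration.mul_fderiv_symm_pos_of_fold_chart` — `0 < σ ∂ₛΓ₂(0)` for
  every centred fold chart `(φ, ψ)` at a round point of `P` (`Γ = ψ⁻¹`).
* `IsSimplifiedBrokenLefschetzFibration.morseIndex_height_comp_incl_eq_of_round` — for every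
  `a = (a₀, 0, a₂)`, `a₀ ≠ 0`, `a₂ ≠ 0`: the index of `⟪a, f⟫|_P` at a round point of `P` is `1`
  if `a₂ σ > 0` and `2` if `a₂ σ < 0`;
  `IsSimplifiedBrokenLefschetzFibration.exists_pole_morseIndex_height_comp_incl_eq` packages this
  with the pole of `exists_pole_lower_higher_sides`.

## References

* R. İ. Baykur, S. Kamada, *Classification of broken Lefschetz fibrations with small fiber
  genera*, J. Math. Soc. Japan 67 (2015), §2 (arXiv:1010.5814, p. 7), Lemma 11. [BaykurKamada2015]
* R. İ. Baykur, *Broken Lefschetz fibrations and smooth structures on 4-manifolds*, Geom. Topol.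
  Monogr. 18 (2012), proof of Lemma 7. [Baykur2012]
* K. Hayano, *On genus-1 simplified broken Lefschetz fibrations*, Algebr. Geom. Topol. 11 (2011),
  Def. 2.1 (4), §2.3. [Hayano2011]
* J. Milnor, *Lectures on the h-cobordism theorem* (1965), §3, Thm. 7.4, proof of Thm. 9.1.
  [MilnorHCobordism1965]
* J. Milnor, *Morse theory* (1963), §2. [Milnor1963]
-/

noncomputable section

open scoped Manifold ContDiff Topology RealInnerProductSpace
open Set Function Filter Metric
open Literature.AlgebraicTopology.SingularHomology

namespace Literature.Topology.FourManifolds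

universe u

/-! ### Bookkeeping: the signed Morse count over a slab with two critical points -/

section Count

variable {E H : Type*} [NormedAddCommGroup E] [NormedSpace ℝ E] [TopologicalSpace H]
  {I : ModelWithCorners ℝ E H} {M : Type*} [TopologicalSpace M] [ChartedSpace H M]

/-- **The signed Morse count over an open slab with exactly two critical points** `p₁ ≠ p₂` of
indices `i₁, i₂ < N` is `(-1)^{i₁} + (-1)^{i₂}` (Milnor 1965, §3: `Σ (-1)^k #Crit_k`).
[cite: MilnorHCobordism1965, §3] -/
theorem morseCount_Ioo_eq_of_pair {g : M → ℝ} {a b : ℝ} {p₁ p₂ : M} (hne : p₁ ≠ p₂)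
    (hS : ∀ q, (IsMCriticalPt I g q ∧ g q ∈ Ioo a b) ↔ (q = p₁ ∨ q = p₂)) {N : ℕ}
    (h₁ : morseIndex I g p₁ < N) (h₂ : morseIndex I g p₂ < N) :
    ∑ k ∈ Finset.range N, (-1 : ℤ) ^ k * ((criticalSetOfIndex I g k ∩ g ⁻¹' Ioo a b).ncard : ℤ) =
      (-1 : ℤ) ^ morseIndex I g p₁ + (-1 : ℤ) ^ morseIndex I g p₂ := by
  classical
  set S : Finset M := {p₁, p₂} with hSdef
  have hmemS : ∀ q, q ∈ S ↔ q = p₁ ∨ q = p₂ := fun q => by simp [hSdef]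
  have hset : ∀ k, criticalSetOfIndex I g k ∩ g ⁻¹' Ioo a b =
      ↑(S.filter fun q => morseIndex I g q = k) := by
    intro k; ext q
    simp only [mem_inter_iff, mem_criticalSetOfIndex, mem_preimage, Finset.coe_filter, mem_setOf_eq]
    constructor
    · rintro ⟨⟨hc, hk⟩, hv⟩
      exact ⟨(hmemS q).2 ((hS q).1 ⟨hc, hv⟩), hk⟩
    · rintro ⟨hq, hk⟩
      obtain ⟨hc, hv⟩ := (hS q).2 ((hmemS q).1 hq)
      exact ⟨⟨hc, hk⟩, hv⟩
  have hN : ∀ q ∈ S, morseIndex I g q < N := by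
    intro q hq
    rcases (hmemS q).1 hq with rfl | rfl
    · exact h₁
    · exact h₂
  simp_rw [hset, Set.ncard_coe_finset]
  rw [sum_neg_one_pow_mul_card_filter S (morseIndex I g) hN, hSdef, Finset.sum_pair hne]

end Count

/-! ### A nondegenerate bilinear form stays nondegenerate under negation -/

section Neg

variable {V : Type*} [AddCommGroup V] [Module ℝ V]

/-- `-B` is nondegenerate when `B` is. [folklore] -/
theorem nondegenerate_neg_of_nondegenerate {B : LinearMap.BilinForm ℝ V} (hB : B.Nondegenerate) :
    (-B).Nondegenerate := by
  obtain ⟨hl, hr⟩ := hB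
  refine ⟨fun v hv => hl v fun w => ?_, fun v hv => hr v fun w => ?_⟩
  · have h := hv w
    simp only [LinearMap.neg_apply, neg_eq_zero] at h
    exact h
  · have h := hv w
    simp only [LinearMap.neg_apply, neg_eq_zero] at h
    exact h

end Neg

/-! ### Round points of the meridian slice -/

namespace IsSimplifiedBrokenLefschetzFibration

open SphereHeight

variable {X : Type u} [TopologicalSpace X] [ChartedSpace (EuclideanSpace ℝ (Fin 4)) X]
  [IsManifold (𝓡 4) ∞ X] {o : SmoothOrientation (𝓡 4) X}
  {f : X → (Metric.sphere (0 : EuclideanSpace ℝ (Fin 3)) 1)} {h : ℕ}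

/-- **The round points of the meridian slice lie over `(±1, 0, 0)`**: a round point `q` with
`(f q)₁ = 0` has `(f q)₂ = 0` (equatorial round image) and `(f q)₀ = ±1` (unit norm). [folklore] -/
theorem apply_two_eq_zero_and_apply_zero_eq_of_round (hf : IsSimplifiedBrokenLefschetzFibration o f ∅ h)
    (hround : f '' ({p : X | ¬ Surjective (mfderiv (𝓡 4) (𝓡 2) f p)} \
      (↑(∅ : Finset X) : Set X)) = sphereEquator 1)
    {q : X} (hqs : ¬ Surjective (mfderiv (𝓡 4) (𝓡 2) f q))
    (hq1 : ((f q : (Metric.sphere (0 : EuclideanSpace ℝ (Fin 3)) 1)) : EuclideanSpace ℝ (Fin 3)) 1 = 0) :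
    ((f q : (Metric.sphere (0 : EuclideanSpace ℝ (Fin 3)) 1)) : EuclideanSpace ℝ (Fin 3)) 2 = 0 ∧
      (((f q : (Metric.sphere (0 : EuclideanSpace ℝ (Fin 3)) 1)) : EuclideanSpace ℝ (Fin 3)) 0 = 1 ∨
        ((f q : (Metric.sphere (0 : EuclideanSpace ℝ (Fin 3)) 1)) : EuclideanSpace ℝ (Fin 3)) 0 = -1) := by
  have _ := hf.contMDiff
  have hmem : f q ∈ sphereEquator 1 := by
    rw [← hround]; exact mem_image_of_mem f ⟨hqs, fun h' => (Finset.notMem_empty q) (Finset.mem_coe.1 h')⟩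
  have hq2 : ((f q : (Metric.sphere (0 : EuclideanSpace ℝ (Fin 3)) 1)) : EuclideanSpace ℝ (Fin 3)) 2 = 0 :=
    (mem_sphereEquator_iff (f q)).1 hmem
  refine ⟨hq2, ?_⟩
  set y : EuclideanSpace ℝ (Fin 3) :=
    ((f q : (Metric.sphere (0 : EuclideanSpace ℝ (Fin 3)) 1)) : EuclideanSpace ℝ (Fin 3)) with hydef
  have hnorm : ‖y‖ = 1 := norm_eq_of_mem_sphere (f q)
  have hsq : y 0 ^ 2 = 1 := by
    have : ‖y‖ ^ 2 = 1 := by rw [hnorm, one_pow]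
    rw [← real_inner_self_eq_norm_sq, BandFoliation.inner_eq_three, hq1, hq2] at this
    nlinarith
  have hprod : (y 0 - 1) * (y 0 + 1) = 0 := by linear_combination hsq
  rcases mul_eq_zero.1 hprod with h0 | h0
  · exact Or.inl (by linarith)
  · exact Or.inr (by linarith)

omit [IsManifold (𝓡 4) ∞ X] in
/-- A point of `S²` with coordinates `(s, 0, 0)` is `⟨single 0 s, _⟩`: two points of the sphere
with `y₁ = y₂ = 0` and the same `y₀` coincide. [folklore] -/
theorem sphere_ext_of_apply_eq {y y' : (Metric.sphere (0 : EuclideanSpace ℝ (Fin 3)) 1)}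
    (h0 : (y : EuclideanSpace ℝ (Fin 3)) 0 = (y' : EuclideanSpace ℝ (Fin 3)) 0)
    (h1 : (y : EuclideanSpace ℝ (Fin 3)) 1 = (y' : EuclideanSpace ℝ (Fin 3)) 1)
    (h2 : (y : EuclideanSpace ℝ (Fin 3)) 2 = (y' : EuclideanSpace ℝ (Fin 3)) 2) : y = y' := by
  ext i
  fin_cases i
  · exact h0
  · exact h1
  · exact h2

/-- **Round points of the slice are determined by the sign of `(f ·)₀`**: two round points of
`P = {(f ·)₁ = 0}` with the same `(f ·)₀` are equal (`f` is injective on the critical set).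
[cite: Hayano2011, Def. 2.1 (5)] -/
theorem eq_of_round_of_apply_zero_eq (hf : IsSimplifiedBrokenLefschetzFibration o f ∅ h)
    (hround : f '' ({p : X | ¬ Surjective (mfderiv (𝓡 4) (𝓡 2) f p)} \
      (↑(∅ : Finset X) : Set X)) = sphereEquator 1)
    {q q' : X} (hqs : ¬ Surjective (mfderiv (𝓡 4) (𝓡 2) f q))
    (hqs' : ¬ Surjective (mfderiv (𝓡 4) (𝓡 2) f q'))
    (hq1 : ((f q : (Metric.sphere (0 : EuclideanSpace ℝ (Fin 3)) 1)) : EuclideanSpace ℝ (Fin 3)) 1 = 0)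
    (hq1' : ((f q' : (Metric.sphere (0 : EuclideanSpace ℝ (Fin 3)) 1)) : EuclideanSpace ℝ (Fin 3)) 1 = 0)
    (h0 : ((f q : (Metric.sphere (0 : EuclideanSpace ℝ (Fin 3)) 1)) : EuclideanSpace ℝ (Fin 3)) 0 =
      ((f q' : (Metric.sphere (0 : EuclideanSpace ℝ (Fin 3)) 1)) : EuclideanSpace ℝ (Fin 3)) 0) :
    q = q' := by
  obtain ⟨hq2, -⟩ := hf.apply_two_eq_zero_and_apply_zero_eq_of_round hround hqs hq1
  obtain ⟨hq2', -⟩ := hf.apply_two_eq_zero_and_apply_zero_eq_of_round hround hqs' hq1'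
  have hfq : f q = f q' := sphere_ext_of_apply_eq h0 (by rw [hq1, hq1']) (by rw [hq2, hq2'])
  exact hf.injOn_crit hqs hqs' hfq

end IsSimplifiedBrokenLefschetzFibration

/-! ### The slice height `a = (3/4, 0, σ)` on the great circle `{y₁ = 0}`: its levels `±1` -/

section SliceHeight

/-- **The two points of the great circle `{y₁ = 0}` at slice height `c = ±1`.**  For `σ = ±1`
and a unit vector `y = (y₀, 0, y₂)` with `(3/4) y₀ + σ y₂ = c`, `c = ±1`: either `y₀ = 0` and
`y₂ = c σ` (the pole `c v`), or `y₀ = (24/25) c` and `y₂ = (7/25) c σ`. [folklore] -/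
theorem apply_eq_of_sliceHeight_eq {y : EuclideanSpace ℝ (Fin 3)} {σ c : ℝ} (hσ : σ = 1 ∨ σ = -1)
    (hc : c = 1 ∨ c = -1) (hy1 : y 1 = 0) (hnorm : y 0 ^ 2 + y 2 ^ 2 = 1)
    (hval : 3 / 4 * y 0 + σ * y 2 = c) :
    (y 0 = 0 ∧ y 2 = c * σ) ∨ (y 0 = 24 / 25 * c ∧ y 2 = 7 / 25 * c * σ) := by
  have _ := hy1
  have hσ2 : σ ^ 2 = 1 := by rcases hσ with rfl | rfl <;> norm_num
  have hc2 : c ^ 2 = 1 := by rcases hc with rfl | rfl <;> norm_num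
  -- `y₂ = σ (c - (3/4) y₀)`
  have hy2 : y 2 = σ * (c - 3 / 4 * y 0) := by
    have : σ * (σ * y 2) = σ * (c - 3 / 4 * y 0) := by rw [show σ * y 2 = c - 3 / 4 * y 0 by linarith]
    calc y 2 = σ ^ 2 * y 2 := by rw [hσ2, one_mul]
      _ = σ * (σ * y 2) := by ring
      _ = σ * (c - 3 / 4 * y 0) := this
  -- the quadratic equation for `y₀`
  have hquad : y 0 * (25 / 16 * y 0 - 3 / 2 * c) = 0 := by
    have h1 : y 0 ^ 2 + (σ * (c - 3 / 4 * y 0)) ^ 2 = 1 := by rw [← hy2]; exact hnorm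
    have h2 : (σ * (c - 3 / 4 * y 0)) ^ 2 = (c - 3 / 4 * y 0) ^ 2 := by
      rw [mul_pow, hσ2, one_mul]
    rw [h2] at h1
    linear_combination h1 - hc2
  rcases mul_eq_zero.1 hquad with h0 | h0
  · left
    refine ⟨h0, ?_⟩
    rw [hy2, h0]; ring
  · right
    have hy0 : y 0 = 24 / 25 * c := by
      have : 25 / 16 * y 0 = 3 / 2 * c := by linarith
      linear_combination (16 / 25) * this
    refine ⟨hy0, ?_⟩
    rw [hy2, hy0]
    ring

end SliceHeight

/-! ### Euler characteristics: disjoint unions, regular fibres, slice levels -/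

section DisjointUnion

/-- **`χ` is additive on a space which is the disjoint union of two closed subspaces**
(Mayer–Vietoris with empty intersection, `finRelHomology_union_of_isOpen`).
[cite: HatcherAT2002, §2.2 pp. 149–150] -/
theorem finRelHomology_and_relEuler_of_isClosed_union {Y : Type u} [TopologicalSpace Y]
    {A B : Set Y} (hA : IsClosed A) (hB : IsClosed B) (hAB : Disjoint A B) (hcov : A ∪ B = univ)
    {N : ℕ} (hfA : FinRelHomology ℤ ℤ (↥A) ∅ N) (hfB : FinRelHomology ℤ ℤ (↥B) ∅ N) :
    FinRelHomology ℤ ℤ Y ∅ (N + 1) ∧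
      relEuler ℤ ℤ Y ∅ = relEuler ℤ ℤ (↥A) ∅ + relEuler ℤ ℤ (↥B) ∅ := by
  have hAeq : A = Bᶜ := by
    refine Subset.antisymm (fun x hx hxB => Set.disjoint_left.1 hAB hx hxB) fun x hx => ?_
    have hx' : x ∈ A ∪ B := (Set.ext_iff.1 hcov x).2 (mem_univ x)
    exact hx'.resolve_right hx
  have hBeq : B = Aᶜ := by rw [hAeq, compl_compl]
  have hAo : IsOpen A := by rw [hAeq]; exact hB.isOpen_compl
  have hBo : IsOpen B := by rw [hBeq]; exact hA.isOpen_compl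
  haveI : IsEmpty ↥(A ∩ B) := Set.isEmpty_coe_sort.2 hAB.inter_eq
  have h0 : FinRelHomology ℤ ℤ (↥(A ∩ B)) ∅ 0 := FinRelHomology.of_isEmpty ∅
  have hχ0 : relEuler ℤ ℤ (↥(A ∩ B)) ∅ = 0 := by
    rw [h0.relEuler_eq_sum, Finset.sum_range_zero]
  obtain ⟨hfin, hχ⟩ := finRelHomology_union_of_isOpen ℤ ℤ hAo hBo hfA hfB (h0.mono (Nat.zero_le N))
  let e : ↥(A ∪ B) ≃ₜ Y := (Homeomorph.setCongr hcov).trans (Homeomorph.Set.univ Y)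
  refine ⟨hfin.of_homeomorph e (mapsTo_empty _ _) (mapsTo_empty _ _), ?_⟩
  rw [← relEuler_eq_of_homeomorph e (mapsTo_empty _ _) (mapsTo_empty _ _), ← hχ, hχ0, add_zero]

end DisjointUnion

namespace IsSimplifiedBrokenLefschetzFibration

open SphereHeight

variable {X : Type u} [TopologicalSpace X] [T2Space X] [SecondCountableTopology X]
  [CompactSpace X] [ChartedSpace (EuclideanSpace ℝ (Fin 4)) X] [IsManifold (𝓡 4) ∞ X]
  {o : SmoothOrientation (𝓡 4) X}
  {f : X → (Metric.sphere (0 : EuclideanSpace ℝ (Fin 3)) 1)} {L : Finset X} {h : ℕ}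

/-- **`χ` of a regular fibre of genus `g` is `2 - 2g`**, on the subspace `f⁻¹(y)` itself
(`exists_oriented_surface_fibre` and `relEuler_eq_of_genus_clause`, transported along the
homeomorphism `F ≃ₜ f⁻¹(y)`). [cite: Baykur2012, Lemma 7] -/
theorem finRelHomology_and_relEuler_preimage_of_genus
    (hf : IsSimplifiedBrokenLefschetzFibration o f L h)
    {y : (Metric.sphere (0 : EuclideanSpace ℝ (Fin 3)) 1)} {g : ℕ}
    (hy : (∀ q, f q = y → Surjective (mfderiv (𝓡 4) (𝓡 2) f q)) ∧
      Nonempty ((Fin (2 * g) → ℤ) ≃ₗ[ℤ] singularHomology ℤ ℤ ↥(f ⁻¹' {y}) 1)) :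
    FinRelHomology ℤ ℤ ↥(f ⁻¹' {y}) ∅ 3 ∧ relEuler ℤ ℤ ↥(f ⁻¹' {y}) ∅ = 2 - 2 * g := by
  obtain ⟨F, _, _, _, _, _, _, _, _e, φ, -, -, -, -, -, hfin, hχ⟩ :=
    hf.exists_oriented_surface_fibre hy.1
  refine ⟨hfin.of_homeomorph φ (mapsTo_empty _ _) (mapsTo_empty _ _), ?_⟩
  rw [← relEuler_eq_of_homeomorph φ (mapsTo_empty _ _) (mapsTo_empty _ _)]
  exact relEuler_eq_of_genus_clause hχ φ hy.2

omit [T2Space X] [SecondCountableTopology X] [CompactSpace X] in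
/-- A pole `v = (0, 0, σ)` of `S²` has `σ = ±1`. [folklore] -/
theorem apply_two_eq_or_of_pole {v : (Metric.sphere (0 : EuclideanSpace ℝ (Fin 3)) 1)}
    (hv0 : (v : EuclideanSpace ℝ (Fin 3)) 0 = 0) (hv1 : (v : EuclideanSpace ℝ (Fin 3)) 1 = 0) :
    (v : EuclideanSpace ℝ (Fin 3)) 2 = 1 ∨ (v : EuclideanSpace ℝ (Fin 3)) 2 = -1 := by
  have hn : ‖(v : EuclideanSpace ℝ (Fin 3))‖ = 1 := norm_eq_of_mem_sphere v
  have h2 : ‖(v : EuclideanSpace ℝ (Fin 3))‖ ^ 2 = 1 := by rw [hn, one_pow]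
  rw [← real_inner_self_eq_norm_sq, BandFoliation.inner_eq_three, hv0, hv1] at h2
  have h' : ((v : EuclideanSpace ℝ (Fin 3)) 2 - 1) * ((v : EuclideanSpace ℝ (Fin 3)) 2 + 1) = 0 := by
    nlinarith [h2]
  rcases mul_eq_zero.1 h' with h1 | h1
  · exact Or.inl (by linarith)
  · exact Or.inr (by linarith)

/-- **The levels `±1` of the slice height are pairs of fibres on one side.**  For the slice
height `a = (3/4, 0, σ)` towards the pole `v = (0, 0, σ)` and `c = ±1`, the level
`{x | (f x)₁ = 0, ⟪a, f x⟫ = c}` of `⟪a, f⟫` on the meridian slice is the disjoint union of the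
fibres over `(0, 0, c σ)` and `(24c/25, 0, 7cσ/25)`, both in the open hemisphere
`{y | c ⟪y, v⟫ > 0}`; if the fibres over that hemisphere are regular of genus `g`, the level has
finitely generated homology and `χ = 2 (2 - 2g)`. [cite: BaykurKamada2015, §2 (arXiv p. 7)]
[cite: Baykur2012, Lemma 7] -/
theorem finRelHomology_and_relEuler_sliceLevel (hf : IsSimplifiedBrokenLefschetzFibration o f L h)
    {v : (Metric.sphere (0 : EuclideanSpace ℝ (Fin 3)) 1)}
    (hv0 : (v : EuclideanSpace ℝ (Fin 3)) 0 = 0) (hv1 : (v : EuclideanSpace ℝ (Fin 3)) 1 = 0)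
    {c : ℝ} (hc : c = 1 ∨ c = -1) {g : ℕ}
    (hside : ∀ y : (Metric.sphere (0 : EuclideanSpace ℝ (Fin 3)) 1),
      0 < c * ⟪(y : EuclideanSpace ℝ (Fin 3)), (v : EuclideanSpace ℝ (Fin 3))⟫ →
        (∀ q, f q = y → Surjective (mfderiv (𝓡 4) (𝓡 2) f q)) ∧
        Nonempty ((Fin (2 * g) → ℤ) ≃ₗ[ℤ] singularHomology ℤ ℤ ↥(f ⁻¹' {y}) 1))
    {a : EuclideanSpace ℝ (Fin 3)} (ha0 : a 0 = 3 / 4) (ha1 : a 1 = 0)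
    (ha2 : a 2 = (v : EuclideanSpace ℝ (Fin 3)) 2) :
    FinRelHomology ℤ ℤ ↥{x : X | ((f x : (Metric.sphere (0 : EuclideanSpace ℝ (Fin 3)) 1)) :
        EuclideanSpace ℝ (Fin 3)) 1 = 0 ∧ height a (f x) = c} ∅ 4 ∧
      relEuler ℤ ℤ ↥{x : X | ((f x : (Metric.sphere (0 : EuclideanSpace ℝ (Fin 3)) 1)) :
        EuclideanSpace ℝ (Fin 3)) 1 = 0 ∧ height a (f x) = c} ∅ = 2 * (2 - 2 * g) := by
  have _ := hf.contMDiff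
  set σ : ℝ := (v : EuclideanSpace ℝ (Fin 3)) 2 with hσdef
  have hσ : σ = 1 ∨ σ = -1 := apply_two_eq_or_of_pole hv0 hv1
  have hσ2 : σ ^ 2 = 1 := by rcases hσ with h1 | h1 <;> rw [h1] <;> norm_num
  have hc2 : c ^ 2 = 1 := by rcases hc with h1 | h1 <;> rw [h1] <;> norm_num
  -- the two points of the level on the great circle `{y₁ = 0}`
  have hyv : (!₂[(0 : ℝ), 0, c * σ] : EuclideanSpace ℝ (Fin 3)) ∈
      Metric.sphere (0 : EuclideanSpace ℝ (Fin 3)) 1 := by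
    rw [mem_sphere_zero_iff_norm, EuclideanSpace.norm_eq, Real.sqrt_eq_one, Fin.sum_univ_three]
    simp only [Matrix.cons_val_zero, Matrix.cons_val_one, Matrix.cons_val,
      Real.norm_eq_abs, sq_abs]
    linear_combination c ^ 2 * hσ2 + hc2
  set yv : (Metric.sphere (0 : EuclideanSpace ℝ (Fin 3)) 1) := ⟨_, hyv⟩ with hyvdef
  have hyv0 : (yv : EuclideanSpace ℝ (Fin 3)) 0 = 0 := by simp [hyvdef]
  have hyv1 : (yv : EuclideanSpace ℝ (Fin 3)) 1 = 0 := by simp [hyvdef]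
  have hyv2 : (yv : EuclideanSpace ℝ (Fin 3)) 2 = c * σ := by simp [hyvdef]
  have hzv : (!₂[24 / 25 * c, 0, 7 / 25 * c * σ] : EuclideanSpace ℝ (Fin 3)) ∈
      Metric.sphere (0 : EuclideanSpace ℝ (Fin 3)) 1 := by
    rw [mem_sphere_zero_iff_norm, EuclideanSpace.norm_eq, Real.sqrt_eq_one, Fin.sum_univ_three]
    simp only [Matrix.cons_val_zero, Matrix.cons_val_one, Matrix.cons_val,
      Real.norm_eq_abs, sq_abs]
    linear_combination (576 / 625 : ℝ) * hc2 + (49 / 625 : ℝ) * c ^ 2 * hσ2 + (49 / 625 : ℝ) * hc2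
  set zv : (Metric.sphere (0 : EuclideanSpace ℝ (Fin 3)) 1) := ⟨_, hzv⟩ with hzvdef
  have hzv0 : (zv : EuclideanSpace ℝ (Fin 3)) 0 = 24 / 25 * c := by simp [hzvdef]
  have hzv1 : (zv : EuclideanSpace ℝ (Fin 3)) 1 = 0 := by simp [hzvdef]
  have hzv2 : (zv : EuclideanSpace ℝ (Fin 3)) 2 = 7 / 25 * c * σ := by simp [hzvdef]
  -- both lie on the side `c ⟪·, v⟫ > 0`
  have hyside : 0 < c * ⟪(yv : EuclideanSpace ℝ (Fin 3)), (v : EuclideanSpace ℝ (Fin 3))⟫ := by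
    rw [BandFoliation.inner_eq_three, hyv0, hyv1, hyv2, hv0, hv1, ← hσdef]
    have : c * (0 * 0 + 0 * 0 + c * σ * σ) = c ^ 2 * σ ^ 2 := by ring
    rw [this, hc2, hσ2]; norm_num
  have hzside : 0 < c * ⟪(zv : EuclideanSpace ℝ (Fin 3)), (v : EuclideanSpace ℝ (Fin 3))⟫ := by
    rw [BandFoliation.inner_eq_three, hzv0, hzv1, hzv2, hv0, hv1, ← hσdef]
    have : c * (24 / 25 * c * 0 + 0 * 0 + 7 / 25 * c * σ * σ) = 7 / 25 * c ^ 2 * σ ^ 2 := by ring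
    rw [this, hc2, hσ2]; norm_num
  have hne : yv ≠ zv := by
    intro heq
    have := congrArg (fun y : (Metric.sphere (0 : EuclideanSpace ℝ (Fin 3)) 1) =>
      (y : EuclideanSpace ℝ (Fin 3)) 0) heq
    simp only [hyv0, hzv0] at this
    rcases hc with h1 | h1 <;> rw [h1] at this <;> norm_num at this
  -- the level is the union of the two fibres
  have hval : ∀ x : X, height a (f x) =
      3 / 4 * ((f x : (Metric.sphere (0 : EuclideanSpace ℝ (Fin 3)) 1)) : EuclideanSpace ℝ (Fin 3)) 0 +
        σ * ((f x : (Metric.sphere (0 : EuclideanSpace ℝ (Fin 3)) 1)) : EuclideanSpace ℝ (Fin 3)) 2 := by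
    intro x
    rw [height_apply, BandFoliation.inner_eq_three, ha0, ha1, ha2]; ring
  have hlevel : {x : X | ((f x : (Metric.sphere (0 : EuclideanSpace ℝ (Fin 3)) 1)) :
      EuclideanSpace ℝ (Fin 3)) 1 = 0 ∧ height a (f x) = c} = f ⁻¹' {yv} ∪ f ⁻¹' {zv} := by
    ext x
    simp only [mem_setOf_eq, mem_union, mem_preimage, mem_singleton_iff]
    set y : EuclideanSpace ℝ (Fin 3) :=
      ((f x : (Metric.sphere (0 : EuclideanSpace ℝ (Fin 3)) 1)) : EuclideanSpace ℝ (Fin 3)) with hydef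
    constructor
    · rintro ⟨hy1, hyc⟩
      rw [hval x] at hyc
      have hnorm : ‖y‖ = 1 := norm_eq_of_mem_sphere (f x)
      have hsq : y 0 ^ 2 + y 2 ^ 2 = 1 := by
        have : ‖y‖ ^ 2 = 1 := by rw [hnorm, one_pow]
        rw [← real_inner_self_eq_norm_sq, BandFoliation.inner_eq_three, hy1] at this
        nlinarith [this]
      rcases apply_eq_of_sliceHeight_eq hσ hc hy1 hsq hyc with ⟨h0, h2⟩ | ⟨h0, h2⟩
      · exact Or.inl (sphere_ext_of_apply_eq (by rw [hyv0]; exact h0) (by rw [hyv1]; exact hy1)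
          (by rw [hyv2]; exact h2))
      · exact Or.inr (sphere_ext_of_apply_eq (by rw [hzv0]; exact h0) (by rw [hzv1]; exact hy1)
          (by rw [hzv2]; exact h2))
    · rintro (hx | hx)
      · have hy : y = (yv : EuclideanSpace ℝ (Fin 3)) := by rw [hydef, hx]
        refine ⟨by rw [hy, hyv1], ?_⟩
        rw [hval x, ← hydef, hy, hyv0, hyv2]
        linear_combination c * hσ2
      · have hy : y = (zv : EuclideanSpace ℝ (Fin 3)) := by rw [hydef, hx]
        refine ⟨by rw [hy, hzv1], ?_⟩
        rw [hval x, ← hydef, hy, hzv0, hzv2]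
        linear_combination (7 / 25 * c) * hσ2
  -- Euler characteristics of the two fibres, and of their disjoint union
  obtain ⟨hfy, hχy⟩ := hf.finRelHomology_and_relEuler_preimage_of_genus (hside yv hyside)
  obtain ⟨hfz, hχz⟩ := hf.finRelHomology_and_relEuler_preimage_of_genus (hside zv hzside)
  rw [hlevel]
  have hcl : ∀ y : (Metric.sphere (0 : EuclideanSpace ℝ (Fin 3)) 1), IsClosed (f ⁻¹' {y}) := fun y =>
    isClosed_singleton.preimage hf.contMDiff.continuous
  -- the traces of the two fibres on the union
  have hA : IsClosed (Subtype.val ⁻¹' (f ⁻¹' {yv}) : Set ↥(f ⁻¹' {yv} ∪ f ⁻¹' {zv})) :=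
    (hcl yv).preimage continuous_subtype_val
  have hB : IsClosed (Subtype.val ⁻¹' (f ⁻¹' {zv}) : Set ↥(f ⁻¹' {yv} ∪ f ⁻¹' {zv})) :=
    (hcl zv).preimage continuous_subtype_val
  have hdisj : Disjoint (Subtype.val ⁻¹' (f ⁻¹' {yv}) : Set ↥(f ⁻¹' {yv} ∪ f ⁻¹' {zv}))
      (Subtype.val ⁻¹' (f ⁻¹' {zv})) := by
    rw [Set.disjoint_left]
    rintro x (hx : f x.1 = yv) (hx' : f x.1 = zv)
    exact hne (hx.symm.trans hx')
  have hcov : (Subtype.val ⁻¹' (f ⁻¹' {yv}) : Set ↥(f ⁻¹' {yv} ∪ f ⁻¹' {zv})) ∪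
      Subtype.val ⁻¹' (f ⁻¹' {zv}) = univ := by
    ext x
    simp only [mem_union, mem_preimage, mem_univ, iff_true]
    exact x.2
  let eA : ↥(Subtype.val ⁻¹' (f ⁻¹' {yv}) : Set ↥(f ⁻¹' {yv} ∪ f ⁻¹' {zv})) ≃ₜ ↥(f ⁻¹' {yv}) :=
    preimageValHomeomorphOfSubset subset_union_left
  let eB : ↥(Subtype.val ⁻¹' (f ⁻¹' {zv}) : Set ↥(f ⁻¹' {yv} ∪ f ⁻¹' {zv})) ≃ₜ ↥(f ⁻¹' {zv}) :=
    preimageValHomeomorphOfSubset subset_union_right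
  have hfA := hfy.of_homeomorph eA.symm (mapsTo_empty _ _) (mapsTo_empty _ _)
  have hfB := hfz.of_homeomorph eB.symm (mapsTo_empty _ _) (mapsTo_empty _ _)
  obtain ⟨hfin, hχ⟩ := finRelHomology_and_relEuler_of_isClosed_union hA hB hdisj hcov hfA hfB
  refine ⟨hfin, ?_⟩
  rw [hχ, relEuler_eq_of_homeomorph eA (mapsTo_empty _ _) (mapsTo_empty _ _),
    relEuler_eq_of_homeomorph eB (mapsTo_empty _ _) (mapsTo_empty _ _), hχy, hχz]
  ring

/-! ### The round points of the slice have index one for the height towards the higher pole -/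

/-- **The transverse slice through a round point is an index-`1` cobordism from the lower to
the higher side** (Baykur 2012, proof of Lemma 7: *"`S¹` times a `3`-dimensional `1`-handle
cobordism"*; Baykur–Kamada 2015, §2: a fibrewise `1`-handle attachment).  Let `f : X → S²` be
a Lefschetz-free SBLF on a closed `4`-manifold with equatorial round image, `v = (0, 0, σ)` the
pole whose hemisphere is the higher side (`exists_pole_lower_higher_sides`), and
`a = (3/4, 0, σ)`.  Then at each of the two round points of the meridian slice
`P = {(f ·)₁ = 0}` the slice function `⟪a, f⟫|_P` has Morse index exactly `1`.  Proof: the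
Morse count of the slab `{-1 ≤ ⟪a, f⟫ ≤ 1} ∩ P` for `⟪a, f⟫|_P` and for `-⟪a, f⟫|_P`
(`finRelHomology_and_relEuler_slab_of_nondegenerate`, `morseIndex_const_sub_add`) against
`χ(top) - χ(bottom) = 2 (-2h) - 2 (2 - 2h) = -4` (`finRelHomology_and_relEuler_sliceLevel`,
`FinRelHomology.triple_mid`). [cite: Baykur2012, proof of Lemma 7]
[cite: BaykurKamada2015, §2 (arXiv p. 7)] [cite: MilnorHCobordism1965, §3, Thm. 7.4, proof of Thm. 9.1] -/
theorem morseIndex_height_comp_incl_eq_one_of_round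
    (hf : IsSimplifiedBrokenLefschetzFibration o f ∅ h)
    (hround : f '' ({p : X | ¬ Surjective (mfderiv (𝓡 4) (𝓡 2) f p)} \
      (↑(∅ : Finset X) : Set X)) = sphereEquator 1)
    {v : (Metric.sphere (0 : EuclideanSpace ℝ (Fin 3)) 1)}
    (hv0 : (v : EuclideanSpace ℝ (Fin 3)) 0 = 0) (hv1 : (v : EuclideanSpace ℝ (Fin 3)) 1 = 0)
    (hlo : ∀ y : (Metric.sphere (0 : EuclideanSpace ℝ (Fin 3)) 1),
      ⟪(y : EuclideanSpace ℝ (Fin 3)), (v : EuclideanSpace ℝ (Fin 3))⟫ < 0 →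
        (∀ q, f q = y → Surjective (mfderiv (𝓡 4) (𝓡 2) f q)) ∧
        Nonempty ((Fin (2 * h) → ℤ) ≃ₗ[ℤ] singularHomology ℤ ℤ ↥(f ⁻¹' {y}) 1))
    (hhi : ∀ y : (Metric.sphere (0 : EuclideanSpace ℝ (Fin 3)) 1),
      ⟪(y : EuclideanSpace ℝ (Fin 3)),
          ((-v : (Metric.sphere (0 : EuclideanSpace ℝ (Fin 3)) 1)) : EuclideanSpace ℝ (Fin 3))⟫ < 0 →
        (∀ q, f q = y → Surjective (mfderiv (𝓡 4) (𝓡 2) f q)) ∧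
        Nonempty ((Fin (2 * (h + 1)) → ℤ) ≃ₗ[ℤ] singularHomology ℤ ℤ ↥(f ⁻¹' {y}) 1))
    {a : EuclideanSpace ℝ (Fin 3)} (ha0 : a 0 = 3 / 4) (ha1 : a 1 = 0)
    (ha2 : a 2 = (v : EuclideanSpace ℝ (Fin 3)) 2)
    (hP : IsRegularLevel (𝓡 4) (height (EuclideanSpace.single (1 : Fin 3) (1 : ℝ)) ∘ f) 0)
    (p : RegularLevel hP) (hps : ¬ Surjective (mfderiv (𝓡 4) (𝓡 2) f p.1)) :
    morseIndex (𝓡 3) ((height a ∘ f) ∘ RegularLevel.incl hP) p = 1 := by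
  classical
  set σ : ℝ := (v : EuclideanSpace ℝ (Fin 3)) 2 with hσdef
  have hσ : σ = 1 ∨ σ = -1 := apply_two_eq_or_of_pole hv0 hv1
  have hσ2 : σ ^ 2 = 1 := by rcases hσ with h1 | h1 <;> rw [h1] <;> norm_num
  have ha0' : a 0 ≠ 0 := by rw [ha0]; norm_num
  have ha2' : a 2 ≠ 0 := by rw [ha2]; rcases hσ with h1 | h1 <;> rw [h1] <;> norm_num
  have hsum : a 0 ^ 2 + a 2 ^ 2 = 25 / 16 := by rw [ha0, ha2, hσ2]; norm_num
  set G : RegularLevel hP → ℝ := (height a ∘ f) ∘ RegularLevel.incl hP with hGdef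
  have hGs : ContMDiff (𝓡 3) 𝓘(ℝ, ℝ) ∞ G :=
    ((contMDiff_height a).comp hf.contMDiff).comp (RegularLevel.contMDiff_incl hP)
  have hGval : ∀ q : RegularLevel hP, G q =
      3 / 4 * ((f q.1 : (Metric.sphere (0 : EuclideanSpace ℝ (Fin 3)) 1)) : EuclideanSpace ℝ (Fin 3)) 0 +
        σ * ((f q.1 : (Metric.sphere (0 : EuclideanSpace ℝ (Fin 3)) 1)) : EuclideanSpace ℝ (Fin 3)) 2 := by
    intro q
    show height a (f q.1) = _
    rw [height_apply, BandFoliation.inner_eq_three, ha0, ha1, ha2]; ring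
  -- critical points of `G` at regular points of `f` have `G² = 25/16`
  have hreg_sq : ∀ q : RegularLevel hP, Surjective (mfderiv (𝓡 4) (𝓡 2) f q.1) →
      IsMCriticalPt (𝓡 3) G q → G q ^ 2 = 25 / 16 := fun q hs hc => by
    have h' := hf.sq_height_eq_of_isMCriticalPt_comp_incl ha1 hP q hs hc
    rw [hsum] at h'
    exact h'
  -- the round points of the slice have `G = ±3/4`
  have hround_val : ∀ q : RegularLevel hP, ¬ Surjective (mfderiv (𝓡 4) (𝓡 2) f q.1) →
      G q = 3 / 4 ∨ G q = -(3 / 4) := fun q hq => by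
    obtain ⟨h2, h0⟩ := hf.apply_two_eq_zero_and_apply_zero_eq_of_round hround hq
      (apply_one_eq_zero_of_regularLevel hP q)
    rw [hGval q, h2]
    rcases h0 with h0 | h0 <;> rw [h0]
    · exact Or.inl (by ring)
    · exact Or.inr (by ring)
  -- a critical point of `G` with value in `(-1, 1)` is a round point
  have hround_of : ∀ q : RegularLevel hP, IsMCriticalPt (𝓡 3) G q → G q ∈ Ioo (-1 : ℝ) 1 →
      ¬ Surjective (mfderiv (𝓡 4) (𝓡 2) f q.1) := fun q hc hq hs => by
    have h' := hreg_sq q hs hc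
    rw [mem_Ioo] at hq
    nlinarith [hq.1, hq.2]
  -- the two round points `p₊`, `p₋` of the slice, over `(±1, 0, 0)`
  obtain ⟨xp, hxps, -, hxp0, hxp1, -⟩ := exists_round_point_over hround (s := (1 : ℝ)) (Or.inl rfl)
  obtain ⟨xm, hxms, -, hxm0, hxm1, -⟩ := exists_round_point_over hround (s := (-1 : ℝ)) (Or.inr rfl)
  obtain ⟨pp, hpp⟩ : ∃ q : RegularLevel hP, q.1 = xp :=
    ⟨⟨xp, show height (EuclideanSpace.single (1 : Fin 3) (1 : ℝ)) (f xp) = 0 by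
      rw [height_single_apply]; exact hxp1⟩, rfl⟩
  obtain ⟨pm, hpm⟩ : ∃ q : RegularLevel hP, q.1 = xm :=
    ⟨⟨xm, show height (EuclideanSpace.single (1 : Fin 3) (1 : ℝ)) (f xm) = 0 by
      rw [height_single_apply]; exact hxm1⟩, rfl⟩
  have hpps : ¬ Surjective (mfderiv (𝓡 4) (𝓡 2) f pp.1) := by rw [hpp]; exact hxps
  have hpms : ¬ Surjective (mfderiv (𝓡 4) (𝓡 2) f pm.1) := by rw [hpm]; exact hxms
  have hpp0 : ((f pp.1 : (Metric.sphere (0 : EuclideanSpace ℝ (Fin 3)) 1)) : EuclideanSpace ℝ (Fin 3)) 0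
      = 1 := by rw [hpp]; exact hxp0
  have hpm0 : ((f pm.1 : (Metric.sphere (0 : EuclideanSpace ℝ (Fin 3)) 1)) : EuclideanSpace ℝ (Fin 3)) 0
      = -1 := by rw [hpm]; exact hxm0
  have hne : pp ≠ pm := by
    intro heq
    have key := congrArg (fun q : RegularLevel hP =>
      ((f q.1 : (Metric.sphere (0 : EuclideanSpace ℝ (Fin 3)) 1)) : EuclideanSpace ℝ (Fin 3)) 0) heq
    simp only [hpp0, hpm0] at key
    norm_num at key
  -- the critical points of `G` in the open slab are exactly `p₊`, `p₋`
  have hS : ∀ q : RegularLevel hP, (IsMCriticalPt (𝓡 3) G q ∧ G q ∈ Ioo (-1 : ℝ) 1) ↔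
      (q = pp ∨ q = pm) := by
    intro q
    constructor
    · rintro ⟨hc, hq⟩
      have hqs := hround_of q hc hq
      obtain ⟨-, h0⟩ := hf.apply_two_eq_zero_and_apply_zero_eq_of_round hround hqs
        (apply_one_eq_zero_of_regularLevel hP q)
      rcases h0 with h0 | h0
      · exact Or.inl ((RegularLevel.isEmbedding_incl hP).injective
          (hf.eq_of_round_of_apply_zero_eq hround hqs hpps (apply_one_eq_zero_of_regularLevel hP q)
            (apply_one_eq_zero_of_regularLevel hP pp) (by rw [h0, hpp0])))
      · exact Or.inr ((RegularLevel.isEmbedding_incl hP).injective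
          (hf.eq_of_round_of_apply_zero_eq hround hqs hpms (apply_one_eq_zero_of_regularLevel hP q)
            (apply_one_eq_zero_of_regularLevel hP pm) (by rw [h0, hpm0])))
    · rintro (rfl | rfl)
      · refine ⟨hf.isMCriticalPt_height_comp_incl_of_round hround ha1 ha0' hP _ hpps, ?_⟩
        rcases hround_val _ hpps with h1 | h1 <;> rw [mem_Ioo, h1] <;> norm_num
      · refine ⟨hf.isMCriticalPt_height_comp_incl_of_round hround ha1 ha0' hP _ hpms, ?_⟩
        rcases hround_val _ hpms with h1 | h1 <;> rw [mem_Ioo, h1] <;> norm_num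
  have hp : p = pp ∨ p = pm :=
    (hS p).1 ⟨hf.isMCriticalPt_height_comp_incl_of_round hround ha1 ha0' hP p hps, by
      rcases hround_val p hps with h1 | h1 <;> rw [mem_Ioo, h1] <;> norm_num⟩
  -- Morse data at `p₊`, `p₋`: nondegenerate of index `1` or `2`
  obtain ⟨-, hip⟩ :=
    hf.nondegenerate_and_morseIndex_height_comp_incl_of_round hround ha1 ha0' ha2' hP pp hpps
  obtain ⟨-, him⟩ :=
    hf.nondegenerate_and_morseIndex_height_comp_incl_of_round hround ha1 ha0' ha2' hP pm hpms
  change morseIndex (𝓡 3) G pp = 1 ∨ morseIndex (𝓡 3) G pp = 2 at hip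
  change morseIndex (𝓡 3) G pm = 1 ∨ morseIndex (𝓡 3) G pm = 2 at him
  -- the bands `[-9/8, -1]`, `[1, 9/8]` are regular, the open slab `(-1, 1)` is Morse
  have hδ : ∀ q : RegularLevel hP, G q ∈ Icc (-1 - 1 / 8 : ℝ) (-1) ∪ Icc (1 : ℝ) (1 + 1 / 8) →
      ¬ IsMCriticalPt (𝓡 3) G q := by
    intro q hq hc
    by_cases hs : Surjective (mfderiv (𝓡 4) (𝓡 2) f q.1)
    · have h25 := hreg_sq q hs hc
      rcases hq with ⟨h1, h2⟩ | ⟨h1, h2⟩ <;> nlinarith [h1, h2, h25]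
    · rcases hround_val q hs with h1 | h1 <;> rcases hq with ⟨h2, h3⟩ | ⟨h2, h3⟩ <;> linarith
  have hnd : ∀ q : RegularLevel hP, G q ∈ Ioo (-1 : ℝ) 1 → IsMCriticalPt (𝓡 3) G q →
      (mhessian (𝓡 3) G q).Nondegenerate := fun q hq hc =>
    (hf.nondegenerate_and_morseIndex_height_comp_incl_of_round hround ha1 ha0' ha2' hP q
      (hround_of q hc hq)).1
  -- the Morse count on the slab `G⁻¹[-1, 1]` relative to the bottom `G = -1`
  obtain ⟨hfinB, hχB⟩ := finRelHomology_and_relEuler_slab_of_nondegenerate (n := 2) (by norm_num)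
    hGs (a := -1) (b := 1) (δ := 1 / 8) (by norm_num) (by norm_num) hδ hnd
  have hcount : ∑ k ∈ Finset.range (2 + 2), (-1 : ℤ) ^ k *
      ((criticalSetOfIndex (𝓡 (2 + 1)) G k ∩ G ⁻¹' Ioo (-1 : ℝ) 1).ncard : ℤ) =
      (-1 : ℤ) ^ morseIndex (𝓡 3) G pp + (-1 : ℤ) ^ morseIndex (𝓡 3) G pm :=
    morseCount_Ioo_eq_of_pair (I := 𝓡 3) hne hS
      (by rcases hip with h1 | h1 <;> rw [h1] <;> norm_num)
      (by rcases him with h1 | h1 <;> rw [h1] <;> norm_num)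
  have hχB' := hχB.trans hcount
  -- turning about: `-G` on the same slab, relative to the top `G = 1`
  have hGd : ∀ q, MDifferentiableAt (𝓡 3) 𝓘(ℝ, ℝ) G q := fun q => hGs.mdifferentiableAt (by simp)
  have hG's : ContMDiff (𝓡 3) 𝓘(ℝ, ℝ) ∞ (fun q => (0 : ℝ) - G q) := contMDiff_const.sub hGs
  have hcrit' : ∀ q, IsMCriticalPt (𝓡 3) (fun q => (0 : ℝ) - G q) q ↔ IsMCriticalPt (𝓡 3) G q :=
    fun q => isMCriticalPt_const_sub_iff 0 (hGd q)
  have hval' : ∀ q, (0 : ℝ) - G q ∈ Ioo (-1 : ℝ) 1 ↔ G q ∈ Ioo (-1 : ℝ) 1 := fun q => by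
    simp only [mem_Ioo]
    constructor <;> rintro ⟨h1, h2⟩ <;> constructor <;> linarith
  have hδ' : ∀ q : RegularLevel hP,
      (0 : ℝ) - G q ∈ Icc (-1 - 1 / 8 : ℝ) (-1) ∪ Icc (1 : ℝ) (1 + 1 / 8) →
      ¬ IsMCriticalPt (𝓡 3) (fun q => (0 : ℝ) - G q) q := by
    intro q hq hc
    refine hδ q ?_ ((hcrit' q).1 hc)
    rcases hq with ⟨h1, h2⟩ | ⟨h1, h2⟩
    · exact Or.inr ⟨by linarith, by linarith⟩
    · exact Or.inl ⟨by linarith, by linarith⟩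
  have hnd' : ∀ q : RegularLevel hP, (0 : ℝ) - G q ∈ Ioo (-1 : ℝ) 1 →
      IsMCriticalPt (𝓡 3) (fun q => (0 : ℝ) - G q) q →
      (mhessian (𝓡 3) (fun q => (0 : ℝ) - G q) q).Nondegenerate := by
    intro q hq hc
    rw [mhessian_const_sub]
    exact nondegenerate_neg_of_nondegenerate (hnd q ((hval' q).1 hq) ((hcrit' q).1 hc))
  obtain ⟨hfinT, hχT⟩ := finRelHomology_and_relEuler_slab_of_nondegenerate (n := 2) (by norm_num)
    hG's (a := -1) (b := 1) (δ := 1 / 8) (by norm_num) (by norm_num) hδ' hnd'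
  have hS' : ∀ q : RegularLevel hP, (IsMCriticalPt (𝓡 3) (fun q => (0 : ℝ) - G q) q ∧
      (0 : ℝ) - G q ∈ Ioo (-1 : ℝ) 1) ↔ (q = pp ∨ q = pm) := fun q => by
    rw [hcrit', hval']
    exact hS q
  -- turning about flips the index: `index_{-G} = 3 - index_G`
  have hflip : ∀ q, IsMCriticalPt (𝓡 3) G q → G q ∈ Ioo (-1 : ℝ) 1 →
      morseIndex (𝓡 3) (fun q => (0 : ℝ) - G q) q + morseIndex (𝓡 3) G q = 3 := by
    intro q hc hq
    have h3 := morseIndex_const_sub_add (I := 𝓡 3) (0 : ℝ) (hnd q hq hc)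
      (mhessian_isSymm_holds (hGs.of_le (by norm_cast)) q)
    rw [finrank_euclideanSpace_fin] at h3
    exact h3
  have hflp := hflip pp ((hS pp).2 (Or.inl rfl)).1 ((hS pp).2 (Or.inl rfl)).2
  have hflm := hflip pm ((hS pm).2 (Or.inr rfl)).1 ((hS pm).2 (Or.inr rfl)).2
  have hcount' : ∑ k ∈ Finset.range (2 + 2), (-1 : ℤ) ^ k *
      ((criticalSetOfIndex (𝓡 (2 + 1)) (fun q => (0 : ℝ) - G q) k ∩
        (fun q => (0 : ℝ) - G q) ⁻¹' Ioo (-1 : ℝ) 1).ncard : ℤ) =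
      (-1 : ℤ) ^ morseIndex (𝓡 3) (fun q => (0 : ℝ) - G q) pp +
        (-1 : ℤ) ^ morseIndex (𝓡 3) (fun q => (0 : ℝ) - G q) pm :=
    morseCount_Ioo_eq_of_pair (I := 𝓡 3) hne hS' (by omega) (by omega)
  have hχT' := hχT.trans hcount'
  -- the slab of `-G` is the slab of `G`, its bottom the top `G = 1`
  have hSS : (fun q => (0 : ℝ) - G q) ⁻¹' Icc (-1 : ℝ) 1 = G ⁻¹' Icc (-1 : ℝ) 1 := by
    ext q
    simp only [mem_preimage, mem_Icc]
    constructor <;> rintro ⟨h1, h2⟩ <;> constructor <;> linarith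
  have hTT : (fun q => (0 : ℝ) - G q) ⁻¹' ({-1} : Set ℝ) = G ⁻¹' {1} := by
    ext q
    simp only [mem_preimage, mem_singleton_iff]
    constructor <;> intro h1 <;> linarith
  rw [hSS, hTT] at hfinT hχT'
  -- the levels `G = ∓1` of the slab: pairs of lower / higher fibres
  have hloside : ∀ y : (Metric.sphere (0 : EuclideanSpace ℝ (Fin 3)) 1),
      0 < (-1 : ℝ) * ⟪(y : EuclideanSpace ℝ (Fin 3)), (v : EuclideanSpace ℝ (Fin 3))⟫ →
        (∀ q, f q = y → Surjective (mfderiv (𝓡 4) (𝓡 2) f q)) ∧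
        Nonempty ((Fin (2 * h) → ℤ) ≃ₗ[ℤ] singularHomology ℤ ℤ ↥(f ⁻¹' {y}) 1) :=
    fun y hy => hlo y (by linarith)
  have hhiside : ∀ y : (Metric.sphere (0 : EuclideanSpace ℝ (Fin 3)) 1),
      0 < (1 : ℝ) * ⟪(y : EuclideanSpace ℝ (Fin 3)), (v : EuclideanSpace ℝ (Fin 3))⟫ →
        (∀ q, f q = y → Surjective (mfderiv (𝓡 4) (𝓡 2) f q)) ∧
        Nonempty ((Fin (2 * (h + 1)) → ℤ) ≃ₗ[ℤ] singularHomology ℤ ℤ ↥(f ⁻¹' {y}) 1) :=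
    fun y hy => hhi y (by rw [coe_neg_sphere, inner_neg_right]; linarith)
  obtain ⟨hfinLB, hχLB⟩ :=
    hf.finRelHomology_and_relEuler_sliceLevel hv0 hv1 (c := -1) (Or.inr rfl) hloside ha0 ha1 ha2
  obtain ⟨hfinLT, hχLT⟩ :=
    hf.finRelHomology_and_relEuler_sliceLevel hv0 hv1 (c := 1) (Or.inl rfl) hhiside ha0 ha1 ha2
  -- the levels of the slab are homeomorphic to these level sets
  have hlev : ∀ c : ℝ, c ∈ Icc (-1 : ℝ) 1 →
      Nonempty (↥(Subtype.val ⁻¹' (G ⁻¹' {c}) : Set ↥(G ⁻¹' Icc (-1 : ℝ) 1)) ≃ₜ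
        ↥{x : X | ((f x : (Metric.sphere (0 : EuclideanSpace ℝ (Fin 3)) 1)) :
          EuclideanSpace ℝ (Fin 3)) 1 = 0 ∧ height a (f x) = c}) := by
    intro c hc
    have hsub : G ⁻¹' {c} ⊆ G ⁻¹' Icc (-1 : ℝ) 1 := by
      intro q hq
      rw [mem_preimage, mem_singleton_iff] at hq
      rw [mem_preimage, hq]
      exact hc
    have hemb : Topology.IsEmbedding
        (RegularLevel.incl hP ∘ (Subtype.val : ↥(G ⁻¹' {c}) → RegularLevel hP)) :=
      (RegularLevel.isEmbedding_incl hP).comp Topology.IsEmbedding.subtypeVal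
    have hrange : range (RegularLevel.incl hP ∘ (Subtype.val : ↥(G ⁻¹' {c}) → RegularLevel hP)) =
        {x : X | ((f x : (Metric.sphere (0 : EuclideanSpace ℝ (Fin 3)) 1)) :
          EuclideanSpace ℝ (Fin 3)) 1 = 0 ∧ height a (f x) = c} := by
      ext x
      constructor
      · rintro ⟨z, rfl⟩
        exact ⟨apply_one_eq_zero_of_regularLevel hP z.1, z.2⟩
      · rintro ⟨hx1, hxc⟩
        have hxP : height (EuclideanSpace.single (1 : Fin 3) (1 : ℝ)) (f x) = 0 := by
          rw [height_single_apply]; exact hx1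
        exact ⟨⟨⟨x, hxP⟩, hxc⟩, rfl⟩
    exact ⟨(preimageValHomeomorphOfSubset hsub).trans
      (hemb.toHomeomorph.trans (Homeomorph.setCongr hrange))⟩
  obtain ⟨eB⟩ := hlev (-1) ⟨le_rfl, by norm_num⟩
  obtain ⟨eT⟩ := hlev 1 ⟨by norm_num, le_rfl⟩
  have hfinBot : FinRelHomology ℤ ℤ
      ↥(Subtype.val ⁻¹' (G ⁻¹' {-1}) : Set ↥(G ⁻¹' Icc (-1 : ℝ) 1)) (Subtype.val ⁻¹' ∅) 4 :=
    (hfinLB.of_homeomorph eB.symm (mapsTo_empty _ _) (mapsTo_empty _ _)).congr_set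
      (Set.preimage_empty).symm
  have hfinTop : FinRelHomology ℤ ℤ
      ↥(Subtype.val ⁻¹' (G ⁻¹' {1}) : Set ↥(G ⁻¹' Icc (-1 : ℝ) 1)) (Subtype.val ⁻¹' ∅) 4 :=
    (hfinLT.of_homeomorph eT.symm (mapsTo_empty _ _) (mapsTo_empty _ _)).congr_set
      (Set.preimage_empty).symm
  have hχBot : relEuler ℤ ℤ
      ↥(Subtype.val ⁻¹' (G ⁻¹' {-1}) : Set ↥(G ⁻¹' Icc (-1 : ℝ) 1)) (Subtype.val ⁻¹' ∅) =
        2 * (2 - 2 * h) := by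
    rw [Set.preimage_empty,
      relEuler_eq_of_homeomorph (R := ℤ) (M := ℤ) eB (mapsTo_empty _ _) (mapsTo_empty _ _)]
    exact hχLB
  have hχTop : relEuler ℤ ℤ
      ↥(Subtype.val ⁻¹' (G ⁻¹' {1}) : Set ↥(G ⁻¹' Icc (-1 : ℝ) 1)) (Subtype.val ⁻¹' ∅) =
        2 * (2 - 2 * (h + 1 : ℕ)) := by
    rw [Set.preimage_empty,
      relEuler_eq_of_homeomorph (R := ℤ) (M := ℤ) eT (mapsTo_empty _ _) (mapsTo_empty _ _)]
    exact hχLT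
  -- the exact sequences of the pairs (slab, bottom) and (slab, top)
  obtain ⟨-, hχSB⟩ := FinRelHomology.triple_mid (R := ℤ) (M := ℤ)
    (empty_subset (Subtype.val ⁻¹' (G ⁻¹' {-1}) : Set ↥(G ⁻¹' Icc (-1 : ℝ) 1))) hfinBot hfinB
  obtain ⟨-, hχST⟩ := FinRelHomology.triple_mid (R := ℤ) (M := ℤ)
    (empty_subset (Subtype.val ⁻¹' (G ⁻¹' {1}) : Set ↥(G ⁻¹' Icc (-1 : ℝ) 1))) hfinTop hfinT
  rw [hχBot, hχB'] at hχSB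
  rw [hχTop, hχT', hχSB] at hχST
  push_cast at hχST
  -- `2 (2 - 2h) + ((-1)^{i₊} + (-1)^{i₋}) = 2 (-2h) + ((-1)^{3 - i₊} + (-1)^{3 - i₋})`
  have hpow1 : (-1 : ℤ) ^ 1 = -1 := by norm_num
  have hpow2 : (-1 : ℤ) ^ 2 = 1 := by norm_num
  rcases hip with h1 | h1 <;> rcases him with h2 | h2
  · rcases hp with rfl | rfl
    · exact h1
    · exact h2
  · exfalso
    have h1' : morseIndex (𝓡 3) (fun q => (0 : ℝ) - G q) pp = 2 := by omega
    have h2' : morseIndex (𝓡 3) (fun q => (0 : ℝ) - G q) pm = 1 := by omega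
    rw [h1, h2, h1', h2', hpow1, hpow2] at hχST
    linarith
  · exfalso
    have h1' : morseIndex (𝓡 3) (fun q => (0 : ℝ) - G q) pp = 1 := by omega
    have h2' : morseIndex (𝓡 3) (fun q => (0 : ℝ) - G q) pm = 2 := by omega
    rw [h1, h2, h1', h2', hpow1, hpow2] at hχST
    linarith
  · exfalso
    have h1' : morseIndex (𝓡 3) (fun q => (0 : ℝ) - G q) pp = 1 := by omega
    have h2' : morseIndex (𝓡 3) (fun q => (0 : ℝ) - G q) pm = 1 := by omega
    rw [h1, h2, h1', h2', hpow1, hpow2] at hχST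
    linarith

/-! ### Consequences: the sign of `∂ₛΓ₂` at the round points, the index for a general height -/

/-- **The `s > 0` side of the fold model is the higher side.**  In every centred fold chart
`(φ, ψ)` at a round point `x` of the meridian slice (`(f x)₁ = 0`), with `Γ = ψ⁻¹ : ℝ² → S²` and
`v = (0, 0, σ)` the higher pole: `σ ∂ₛΓ₂(0) > 0` — the image under `Γ` of the side `s > 0` of
the fold value curve `{s = 0}` (where the local fibres `{x₁² + x₂² - x₃² = s}` are connected
hyperboloids, i.e. after the fibrewise `1`-handle attachment) points towards the higher-genus
hemisphere.  (From `morseIndex_height_comp_incl_eq_one_of_round` and the chart formula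
`nondegenerate_and_morseIndex_height_comp_incl_of_fold_chart` for `a = (3/4, 0, σ)`.)
[cite: BaykurKamada2015, §2 (arXiv p. 7)] [cite: Hayano2011, Def. 2.1 (4), §2.3] -/
theorem mul_fderiv_symm_pos_of_fold_chart
    (hf : IsSimplifiedBrokenLefschetzFibration o f ∅ h)
    (hround : f '' ({p : X | ¬ Surjective (mfderiv (𝓡 4) (𝓡 2) f p)} \
      (↑(∅ : Finset X) : Set X)) = sphereEquator 1)
    {v : (Metric.sphere (0 : EuclideanSpace ℝ (Fin 3)) 1)}
    (hv0 : (v : EuclideanSpace ℝ (Fin 3)) 0 = 0) (hv1 : (v : EuclideanSpace ℝ (Fin 3)) 1 = 0)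
    (hlo : ∀ y : (Metric.sphere (0 : EuclideanSpace ℝ (Fin 3)) 1),
      ⟪(y : EuclideanSpace ℝ (Fin 3)), (v : EuclideanSpace ℝ (Fin 3))⟫ < 0 →
        (∀ q, f q = y → Surjective (mfderiv (𝓡 4) (𝓡 2) f q)) ∧
        Nonempty ((Fin (2 * h) → ℤ) ≃ₗ[ℤ] singularHomology ℤ ℤ ↥(f ⁻¹' {y}) 1))
    (hhi : ∀ y : (Metric.sphere (0 : EuclideanSpace ℝ (Fin 3)) 1),
      ⟪(y : EuclideanSpace ℝ (Fin 3)),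
          ((-v : (Metric.sphere (0 : EuclideanSpace ℝ (Fin 3)) 1)) : EuclideanSpace ℝ (Fin 3))⟫ < 0 →
        (∀ q, f q = y → Surjective (mfderiv (𝓡 4) (𝓡 2) f q)) ∧
        Nonempty ((Fin (2 * (h + 1)) → ℤ) ≃ₗ[ℤ] singularHomology ℤ ℤ ↥(f ⁻¹' {y}) 1))
    {x : X} (hx1 : ((f x : (Metric.sphere (0 : EuclideanSpace ℝ (Fin 3)) 1)) :
      EuclideanSpace ℝ (Fin 3)) 1 = 0)
    {φ : OpenPartialHomeomorph X (EuclideanSpace ℝ (Fin 4))}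
    {ψ : OpenPartialHomeomorph (Metric.sphere (0 : EuclideanSpace ℝ (Fin 3)) 1)
      (EuclideanSpace ℝ (Fin 2))}
    (hq : x ∈ φ.source) (hq0 : φ x = 0) (hmaps : Set.MapsTo f φ.source ψ.source)
    (hφ : ContMDiffOn (𝓡 4) (𝓡 4) ∞ φ φ.source) (hφs : ContMDiffOn (𝓡 4) (𝓡 4) ∞ φ.symm φ.target)
    (hψ : ContMDiffOn (𝓡 2) (𝓡 2) ∞ ψ ψ.source) (hψs : ContMDiffOn (𝓡 2) (𝓡 2) ∞ ψ.symm ψ.target)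
    (hmodel : ∀ q ∈ φ.source, (ψ (f q)) 0 = (φ q) 0 ∧
      (ψ (f q)) 1 = (φ q) 1 ^ 2 + (φ q) 2 ^ 2 - (φ q) 3 ^ 2) :
    0 < (v : EuclideanSpace ℝ (Fin 3)) 2 *
      fderiv ℝ (fun w => ((ψ.symm w : Metric.sphere (0 : EuclideanSpace ℝ (Fin 3)) 1) :
        EuclideanSpace ℝ (Fin 3))) 0 (EuclideanSpace.single (1 : Fin 2) (1 : ℝ)) 2 := by
  have hP : IsRegularLevel (𝓡 4) (height (EuclideanSpace.single (1 : Fin 3) (1 : ℝ)) ∘ f) 0 :=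
    hf.isRegularLevel_height_single_one_comp hround
  have hxP : height (EuclideanSpace.single (1 : Fin 3) (1 : ℝ)) (f x) = 0 := by
    rw [height_single_apply]; exact hx1
  obtain ⟨p, hp⟩ : ∃ p : RegularLevel hP, p.1 = x := ⟨⟨x, hxP⟩, rfl⟩
  subst hp
  obtain ⟨a, ha0, ha1, ha2⟩ : ∃ a : EuclideanSpace ℝ (Fin 3),
      a 0 = 3 / 4 ∧ a 1 = 0 ∧ a 2 = (v : EuclideanSpace ℝ (Fin 3)) 2 :=
    ⟨!₂[(3 / 4 : ℝ), 0, (v : EuclideanSpace ℝ (Fin 3)) 2], by simp, by simp, by simp⟩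
  have hσ := apply_two_eq_or_of_pole hv0 hv1
  have ha0' : a 0 ≠ 0 := by rw [ha0]; norm_num
  have ha2' : a 2 ≠ 0 := by rw [ha2]; rcases hσ with h1 | h1 <;> rw [h1] <;> norm_num
  -- `x` is a round point (the axis of a centred fold chart is critical)
  have hps : ¬ Surjective (mfderiv (𝓡 4) (𝓡 2) f p.1) := by
    intro hs
    have h1' : (1 : ℕ∞ω) ≤ ∞ := by exact_mod_cast le_top
    have h1 := (surjective_mfderiv_iff_of_fold_chart hmaps (hφ.of_le h1') (hφs.of_le h1')
      (hψ.of_le h1') (hψs.of_le h1') hmodel hq (hf.contMDiff.mdifferentiableAt (by simp))).1 hs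
    rw [hq0] at h1
    simp at h1
  obtain ⟨-, hind⟩ := hf.nondegenerate_and_morseIndex_height_comp_incl_of_fold_chart hround ha1
    ha0' ha2' hP p hq hq0 hmaps hφ hφs hψ hψs hmodel
  have h1 := hf.morseIndex_height_comp_incl_eq_one_of_round hround hv0 hv1 hlo hhi ha0 ha1 ha2
    hP p hps
  rw [hind, ha2] at h1
  by_contra hneg
  rw [if_neg hneg] at h1
  norm_num at h1

/-- **The index of a slice height at a round point, for a general height.**  For
`a = (a₀, 0, a₂)` with `a₀ ≠ 0`, `a₂ ≠ 0` and the higher pole `v = (0, 0, σ)`, the Morse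
index of `⟪a, f⟫|_P` at a round point of the meridian slice `P` is `1` if `a₂ σ > 0` (the
height increases towards the higher side) and `2` if `a₂ σ < 0`.
[cite: BaykurKamada2015, §2 (arXiv p. 7)] [cite: Milnor1963, §2] -/
theorem morseIndex_height_comp_incl_eq_of_round
    (hf : IsSimplifiedBrokenLefschetzFibration o f ∅ h)
    (hround : f '' ({p : X | ¬ Surjective (mfderiv (𝓡 4) (𝓡 2) f p)} \
      (↑(∅ : Finset X) : Set X)) = sphereEquator 1)
    {v : (Metric.sphere (0 : EuclideanSpace ℝ (Fin 3)) 1)}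
    (hv0 : (v : EuclideanSpace ℝ (Fin 3)) 0 = 0) (hv1 : (v : EuclideanSpace ℝ (Fin 3)) 1 = 0)
    (hlo : ∀ y : (Metric.sphere (0 : EuclideanSpace ℝ (Fin 3)) 1),
      ⟪(y : EuclideanSpace ℝ (Fin 3)), (v : EuclideanSpace ℝ (Fin 3))⟫ < 0 →
        (∀ q, f q = y → Surjective (mfderiv (𝓡 4) (𝓡 2) f q)) ∧
        Nonempty ((Fin (2 * h) → ℤ) ≃ₗ[ℤ] singularHomology ℤ ℤ ↥(f ⁻¹' {y}) 1))
    (hhi : ∀ y : (Metric.sphere (0 : EuclideanSpace ℝ (Fin 3)) 1),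
      ⟪(y : EuclideanSpace ℝ (Fin 3)),
          ((-v : (Metric.sphere (0 : EuclideanSpace ℝ (Fin 3)) 1)) : EuclideanSpace ℝ (Fin 3))⟫ < 0 →
        (∀ q, f q = y → Surjective (mfderiv (𝓡 4) (𝓡 2) f q)) ∧
        Nonempty ((Fin (2 * (h + 1)) → ℤ) ≃ₗ[ℤ] singularHomology ℤ ℤ ↥(f ⁻¹' {y}) 1))
    {a : EuclideanSpace ℝ (Fin 3)} (ha1 : a 1 = 0) (ha0 : a 0 ≠ 0) (ha2 : a 2 ≠ 0)
    (hP : IsRegularLevel (𝓡 4) (height (EuclideanSpace.single (1 : Fin 3) (1 : ℝ)) ∘ f) 0)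
    (p : RegularLevel hP) (hps : ¬ Surjective (mfderiv (𝓡 4) (𝓡 2) f p.1)) :
    morseIndex (𝓡 3) ((height a ∘ f) ∘ RegularLevel.incl hP) p =
      if 0 < a 2 * (v : EuclideanSpace ℝ (Fin 3)) 2 then 1 else 2 := by
  obtain ⟨φ, ψ, hq, hq0, hmaps, hφ, hφs, hψ, hψs, hmodel⟩ := hf.fold p.1 hps (Finset.notMem_empty _)
  obtain ⟨-, hind⟩ := hf.nondegenerate_and_morseIndex_height_comp_incl_of_fold_chart hround ha1 ha0
    ha2 hP p hq hq0 hmaps hφ hφs hψ hψs hmodel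
  have hpos := hf.mul_fderiv_symm_pos_of_fold_chart hround hv0 hv1 hlo hhi
    (apply_one_eq_zero_of_regularLevel hP p) hq hq0 hmaps hφ hφs hψ hψs hmodel
  rw [hind]
  have hσ := apply_two_eq_or_of_pole hv0 hv1
  have hσ2 : (v : EuclideanSpace ℝ (Fin 3)) 2 ^ 2 = 1 := by
    rcases hσ with h1 | h1 <;> rw [h1] <;> norm_num
  have key : a 2 * fderiv ℝ (fun w => ((ψ.symm w : Metric.sphere (0 : EuclideanSpace ℝ (Fin 3)) 1) :
      EuclideanSpace ℝ (Fin 3))) 0 (EuclideanSpace.single (1 : Fin 2) (1 : ℝ)) 2 =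
      (a 2 * (v : EuclideanSpace ℝ (Fin 3)) 2) * ((v : EuclideanSpace ℝ (Fin 3)) 2 *
        fderiv ℝ (fun w => ((ψ.symm w : Metric.sphere (0 : EuclideanSpace ℝ (Fin 3)) 1) :
          EuclideanSpace ℝ (Fin 3))) 0 (EuclideanSpace.single (1 : Fin 2) (1 : ℝ)) 2) := by
    linear_combination (-(a 2) * fderiv ℝ (fun w => ((ψ.symm w :
      Metric.sphere (0 : EuclideanSpace ℝ (Fin 3)) 1) : EuclideanSpace ℝ (Fin 3))) 0
        (EuclideanSpace.single (1 : Fin 2) (1 : ℝ)) 2) * hσ2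
  have hiff : 0 < a 2 * fderiv ℝ (fun w => ((ψ.symm w : Metric.sphere (0 : EuclideanSpace ℝ (Fin 3)) 1) :
      EuclideanSpace ℝ (Fin 3))) 0 (EuclideanSpace.single (1 : Fin 2) (1 : ℝ)) 2 ↔
      0 < a 2 * (v : EuclideanSpace ℝ (Fin 3)) 2 := by
    rw [key]
    constructor
    · intro h'
      by_contra hle
      rw [not_lt] at hle
      nlinarith [h', hpos, hle]
    · intro h'
      exact mul_pos h' hpos
  by_cases hc : 0 < a 2 * (v : EuclideanSpace ℝ (Fin 3)) 2
  · rw [if_pos (hiff.2 hc), if_pos hc]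
  · rw [if_neg (fun h' => hc (hiff.1 h')), if_neg hc]

/-- **Packaged form**: for a Lefschetz-free SBLF on a closed `4`-manifold with equatorial round
image there is a pole `v = (0, 0, σ)` whose hemisphere is the higher side (regular values with
`H₁(fibre) ≅ ℤ^{2(h+1)}`), the opposite hemisphere being the lower side, such that for every
`a = (a₀, 0, a₂)` (`a₀ ≠ 0`, `a₂ ≠ 0`) the slice function `⟪a, f⟫` on the meridian slice
`P = {(f ·)₁ = 0}` has at each round point of `P` a nondegenerate critical point of index `1`
if `a₂ σ > 0` and `2` if `a₂ σ < 0` — the round crossing from the lower to the higher side is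
a `3`-dimensional `1`-handle (times `S¹`). [cite: Baykur2012, proof of Lemma 7]
[cite: BaykurKamada2015, §2 (arXiv p. 7)] -/
theorem exists_pole_morseIndex_height_comp_incl_eq
    (hf : IsSimplifiedBrokenLefschetzFibration o f ∅ h)
    (hround : f '' ({p : X | ¬ Surjective (mfderiv (𝓡 4) (𝓡 2) f p)} \
      (↑(∅ : Finset X) : Set X)) = sphereEquator 1) :
    ∃ v : (Metric.sphere (0 : EuclideanSpace ℝ (Fin 3)) 1),
      (v : EuclideanSpace ℝ (Fin 3)) 0 = 0 ∧ (v : EuclideanSpace ℝ (Fin 3)) 1 = 0 ∧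
      (∀ y : (Metric.sphere (0 : EuclideanSpace ℝ (Fin 3)) 1),
        ⟪(y : EuclideanSpace ℝ (Fin 3)), (v : EuclideanSpace ℝ (Fin 3))⟫ < 0 →
          (∀ q, f q = y → Surjective (mfderiv (𝓡 4) (𝓡 2) f q)) ∧
          Nonempty ((Fin (2 * h) → ℤ) ≃ₗ[ℤ] singularHomology ℤ ℤ ↥(f ⁻¹' {y}) 1)) ∧
      (∀ y : (Metric.sphere (0 : EuclideanSpace ℝ (Fin 3)) 1),
        ⟪(y : EuclideanSpace ℝ (Fin 3)),
            ((-v : (Metric.sphere (0 : EuclideanSpace ℝ (Fin 3)) 1)) : EuclideanSpace ℝ (Fin 3))⟫ < 0 →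
          (∀ q, f q = y → Surjective (mfderiv (𝓡 4) (𝓡 2) f q)) ∧
          Nonempty ((Fin (2 * (h + 1)) → ℤ) ≃ₗ[ℤ] singularHomology ℤ ℤ ↥(f ⁻¹' {y}) 1)) ∧
      ∀ (hP : IsRegularLevel (𝓡 4) (height (EuclideanSpace.single (1 : Fin 3) (1 : ℝ)) ∘ f) 0)
        (p : RegularLevel hP), ¬ Surjective (mfderiv (𝓡 4) (𝓡 2) f p.1) →
        ∀ a : EuclideanSpace ℝ (Fin 3), a 1 = 0 → a 0 ≠ 0 → a 2 ≠ 0 →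
          (mhessian (𝓡 3) ((height a ∘ f) ∘ RegularLevel.incl hP) p).Nondegenerate ∧
          morseIndex (𝓡 3) ((height a ∘ f) ∘ RegularLevel.incl hP) p =
            if 0 < a 2 * (v : EuclideanSpace ℝ (Fin 3)) 2 then 1 else 2 := by
  obtain ⟨v, hv0, hv1, hlo, hhi⟩ := hf.exists_pole_lower_higher_sides hround
  refine ⟨v, hv0, hv1, hlo, hhi, fun hP p hps a ha1 ha0 ha2 => ⟨?_, ?_⟩⟩
  · exact (hf.nondegenerate_and_morseIndex_height_comp_incl_of_round hround ha1 ha0 ha2 hP p hps).1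
  · exact hf.morseIndex_height_comp_incl_eq_of_round hround hv0 hv1 hlo hhi ha1 ha0 ha2 hP p hps

end IsSimplifiedBrokenLefschetzFibration

end Literature.Topology.FourManifolds
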